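import Literature.MathematicalPhysics.QuantumFieldTheory.Balaban1983to89.B8Prop5KLevelLetters

/-!
# `Balaban1983to89.B8Prop5KLevelLettersG` — [Balaban1985RegularSpaces] PROPOSITION 5's SOCKETS FOR THE **`G`-VALUED** THEOREM-4 DRIVER FROM THE PLAIN-CURRENCY
# FIXED POINT WITH THE CLAUSE `e^{iλ} ∈ G` (print p. 76 «G = SU(N)»: `λ` trace-free), plus the two pieces of group bookkeeping the `G`-valued Prop-6 chain reads:
# the gauge-fixed field of a `G`-valued datum is `G`-valued, and the exponent of a small `G`-valued datum is `τ`-free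

statement-level skeleton of published theorems with citation tags; proofs where landed; nothing here is a claim about the Yang–Mills mass gap

T. Bałaban, *Spaces of regular gauge field configurations on a lattice and gauge fixing conditions*, Commun. Math. Phys. **99** (1985) 75–102
`[Balaban1985RegularSpaces]` ("B8"): Prop. 5 (1.106)–(1.110) pp. 93–94, Thm 4 p. 88, (1.66)–(1.69) p. 88, (1.86)–(1.88) p. 91, (1.38) p. 82, p. 76 («we consider … G = SU(N)»);
T. Bałaban, *Averaging operations for lattice gauge theories*, CMP **98** (1985) 17–51 `[Balaban1985Averaging]` (21)–(23) p. 21, (55) p. 27, p. 20.  STATUS: published,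
refereed.

CITATION HEADER (lean-in-tree rule).  Cell `pub-ymgap` (HUMAN RULING D-0062, Track A), DAG node N05 = [B8], seat `pub-ymgap-dag-n05-e` g33 (Prop-6 γ-crown authoring
lineage), CROSS-CELL SERVICE for cell `ym3-torus` (LEAD-H ★ym-ust-19200-w5 g6, line H-P6J of crux stmt-QuantumFields-19200; pub-ymgap bus XCELL-1∕2, INTENT-G1 (F4 §1)):
the two «G-bridges» between ym3-torus's trace-free Proposition-5 bodies (`B8SockHFPTraceFree.sockHFP₀_body_of_join_RD_traceFree`, `B8SockHFP59GammaTraceFree.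
sockHFP_body_of_join_59_γ_traceFree`: `λ` Hermitian with `τ(λ) = 0`) and the sockets of their `G`-valued Theorem-4 driver (`B8Thm4SupportLocalBdryG.
thm4_exists_all_levels_supp_landau138_γ_mem`: `v ∈ G`).  The bridges are GROUP-THEORETIC (no `τ`): the fixed point is asked with the clause `∀ x, e^{iλ(x)} ∈ G`, which a
consumer produces from `τ(λ) = 0` by its closure hypothesis (at `SU(N)`: `B8SpecialUnitaryTrace.gaugeExp_mem_specialUnitaryUnits`).  WHAT IS CERTIFIED.  §1
`mem_of_mgauge_eq` (`B8Prop3GaugeFixedKLevel.mem_unitaryUnits_of_mgauge_eq` for any subgroup), `norm_exp_I_smul_sub_one_le_eighth_of_le_twelfth`,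
`apply_eq_zero_of_cfgExp_mem_of_le_twelfth` (ym3-torus's `B8SockHFPTorusTraceFree.apply_eq_zero_of_cfgExp_mem` with the window `η|A| ≤ 1∕12` = Theorem 4's `c⋆ ≤ 1∕12`
instead of `1∕16`: `e^{1∕12} − 1 < ⅛`).  §2 ★ `hP5_step_of_HFP_mem`, ★ `hP5_of_HFP_mem`, ★ `hP5base_of_HFP_mem` — n05-a∕lit's `B8Prop5KLevelLetters.hP5_step_of_HFP` ∕
`hP5_of_HFP` ∕ `hP5base_of_HFP` VERBATIM (statements and proofs) with the `G`-clause threaded.  Kind «kernel-checked proof», theorems only: no `def`, no `… : Prop`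
fact, no `instance`, no `notation`, no existing module modified.  `--supports stmt-QuantumFields-19200` (ym3-torus's crux; count-neutral for both cells).

HONEST SCOPE.  Bookkeeping over landed theorems; Proposition 5's fixed point is a HYPOTHESIS of the bridges (discharged by the trace-free bodies two files up the
`G`-chain); nothing of [B8] asserted; N05's Track-A status untouched; rung R3 is ym3-torus's and NOT Clay; pub-ymgap = one finite 𝕋⁴ programme at fixed ε; nothing
continuum ∕ ℝ⁴ ∕ OS ∕ mass-gap ∕ Clay.  No `sorry`, no `def`.
-/

noncomputable section

open NormedSpace
open Complex (I I_ne_zero)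

namespace Literature.MathematicalPhysics.QuantumFieldTheory.Balaban1983to89.B8Prop5KLevelLettersG

open MatrixLog B7Prop1Explicit B7Prop2Explicit B7Eq92Concrete
open B7Eq78Linearization (conjR)
open B8Ineq132 (covDerivFwd covDeriv BondTouches)
open B8Eq182Proof (gAd)
open B8Eq184Proof (gaugeExp cfgExp)
open B8Eq188Proof (frakF3)
open B8Eq138LandauZd (covDivB covLap QT logCfg IsLandau138 IsLandau138W)
open B8Eq140Level (SideTouches)
open B8Eq119TwistedAxial (Restr129)
open B8Prop3GaugeFixedKLevel (eq_mgauge_inv_of_mgauge_eq)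
open B8Thm4TruncationLocal (base_datum)
open B8Prop5KLevelLetters (isLandau138W_gaugeFixed_of_multiplier)

-- `Site` alone could resolve to the torus sites of `Setup.lean`; re-export the `ℤ^d` sites of `B7Prop1Explicit`.
export B7Prop1Explicit (Site)

variable {d : ℕ}

/-! ## §1  Group bookkeeping: the gauge-fixed field of a `G`-valued datum; the exponent of a small `G`-valued datum is `τ`-free -/

section Group

variable {𝔹 : Type*} [CStarAlgebra 𝔹] [Nontrivial 𝔹]

omit [Nontrivial 𝔹] in
/-- **The gauge-fixed field of a `G`-valued datum is `G`-valued**: if `U₀, U′` are `G`-valued, `u` is `G`-valued and `W^{u} = U′` in the sense of (55)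
(`mgauge U₀ u W = U′`), then `W` is `G`-valued (`W(b) = u(b₋)⁻¹·U′(b)·R_{U₀(b)}(u(b₊))⁻¹`; `B8Prop3GaugeFixedKLevel.mem_unitaryUnits_of_mgauge_eq` for a general subgroup).
[cite: Balaban1985Averaging, (55)–(57) p.27; Balaban1985RegularSpaces, p.76 («G = SU(N)»)] -/
theorem mem_of_mgauge_eq {G : Subgroup 𝔹ˣ} {U₀ U' W : Site d → Fin d → 𝔹ˣ} {u : Site d → 𝔹ˣ}
    (hU₀ : ∀ x κ, U₀ x κ ∈ G) (hU' : ∀ x κ, U' x κ ∈ G) (hu : ∀ x, u x ∈ G)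
    (hW : mgauge U₀ u W = U') (x : Site d) (κ : Fin d) : W x κ ∈ G := by
  rw [eq_mgauge_inv_of_mgauge_eq hW, mgauge_apply]
  have hui : ∀ y, u⁻¹ y ∈ G := fun y => G.inv_mem (hu y)
  refine G.mul_mem (G.mul_mem (hui x) (hU' x κ)) (G.inv_mem ?_)
  rw [Rc_apply]
  exact G.mul_mem (G.mul_mem (hU₀ x κ) (hui _)) (G.inv_mem (hU₀ x κ))

omit [Nontrivial 𝔹] in
/-- `‖e^{i s} − 1‖ ≤ ⅛` for `‖s‖ ≤ 1/12` (`‖eᵃ − 1‖ ≤ e^{‖a‖} − 1 ≤ ‖a‖ + ‖a‖²` for `‖a‖ ≤ 1`; `1∕12 + 1∕144 < ⅛`) — the window of Theorem 4's datum `η|A| ≤ c⋆ ≤ 1∕12`.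
[cite: Balaban1985Averaging, (22)–(23) p.21; Balaban1985RegularSpaces, (1.69) p.88] -/
theorem norm_exp_I_smul_sub_one_le_eighth_of_le_twelfth {s : 𝔹} (hs : ‖s‖ ≤ 1 / 12) : ‖exp (I • s) - 1‖ ≤ 1 / 8 := by
  have h1 := Literature.Analysis.Calculus.norm_exp_sub_one_le (I • s)
  have hn : ‖I • s‖ = ‖s‖ := by rw [norm_smul, Complex.norm_I, one_mul]
  rw [hn] at h1
  have hx0 : 0 ≤ ‖s‖ := norm_nonneg _
  have h2 : Real.exp ‖s‖ ≤ 1 + ‖s‖ + ‖s‖ ^ 2 := by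
    have := (abs_le.mp (Real.abs_exp_sub_one_sub_id_le (x := ‖s‖) (abs_le.mpr ⟨by linarith, by linarith⟩))).2
    linarith
  nlinarith

omit [Nontrivial 𝔹] in
/-- **The exponent of a small `G`-valued datum is `τ`-free** (ym3-torus's `B8SockHFPTorusTraceFree.apply_eq_zero_of_cfgExp_mem` at Theorem 4's window): if
`e^{iηA(b)} ∈ G ≤ H` with `η‖A(b)‖ ≤ 1∕12` and (H2) `τ(log h) = 0` for `h ∈ H`, `‖h − 1‖ ≤ ⅛`, then `τ(A(b)) = 0` (`log e^{iηA} = iηA` for `‖ηA‖ < ln 2`).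
[cite: Balaban1985RegularSpaces, p.76, (1.69) p.88; Balaban1985Averaging, p.20, (21)–(23) p.21] -/
theorem apply_eq_zero_of_cfgExp_mem_of_le_twelfth (τ : 𝔹 →L[ℂ] ℂ) {G H : Subgroup 𝔹ˣ} (hGH : G ≤ H)
    (hGrp2 : ∀ g ∈ H, ‖(g : 𝔹) - 1‖ ≤ 1 / 8 → τ (mlog (g : 𝔹)) = 0) {η : ℝ} (hη : 0 < η)
    {A : Site d → Fin d → 𝔹} {x : Site d} {κ : Fin d} (hmem : cfgExp η A x κ ∈ G) (hsmall : η * ‖A x κ‖ ≤ 1 / 12) : τ (A x κ) = 0 := by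
  have hn : ‖η • A x κ‖ ≤ 1 / 12 := by rw [norm_smul, Real.norm_eq_abs, abs_of_pos hη]; exact hsmall
  have hval : ((cfgExp η A x κ : 𝔹ˣ) : 𝔹) = exp (I • (η • A x κ)) := rfl
  have h8 : ‖((cfgExp η A x κ : 𝔹ˣ) : 𝔹) - 1‖ ≤ 1 / 8 := by rw [hval]; exact norm_exp_I_smul_sub_one_le_eighth_of_le_twelfth hn
  have hlog := hGrp2 _ (hGH hmem) h8
  have hlt : ‖I • (η • A x κ)‖ < Real.log 2 := by
    rw [norm_smul, Complex.norm_I, one_mul]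
    have := Real.log_two_gt_d9; linarith
  have hsm : I • (η • A x κ) = ((I * (η : ℂ)) : ℂ) • A x κ := by
    rw [RCLike.real_smul_eq_coe_smul (K := ℂ) η (A x κ), smul_smul]; rfl
  rw [hval, B7BlockAvgLog.mlog_exp hlt, hsm, map_smul, smul_eq_mul] at hlog
  have hI : (I : ℂ) ≠ 0 := Complex.I_ne_zero
  have hη' : ((η : ℝ) : ℂ) ≠ 0 := by exact_mod_cast hη.ne'
  exact (mul_eq_zero.1 hlog).resolve_left (mul_ne_zero hI hη')

end Group

/-! ## §2  The `G`-bridges: Proposition 5's sockets of the `G`-valued driver from the plain-currency fixed point with `e^{iλ} ∈ G` -/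

section Assembly

/-- p. 77's «at least one end-point» side condition implies the plaquette-side condition, `d ≥ 2` (private device, as in `B8Prop5KLevelLetters`).
[cite: Balaban1985RegularSpaces, p.77 (convention before (1.5))] -/
private theorem sideTouches_of_bondTouches₂ (hd2 : 2 ≤ d) {S : Set (Site d)} {y : Site d} {τ : Fin d}
    (hb : BondTouches S y τ) : SideTouches S y τ := by
  haveI : Nontrivial (Fin d) := Fin.nontrivial_iff_two_le.mpr hd2
  obtain ⟨κ, hκ⟩ := exists_ne τ
  exact B8Eq140Level.sideTouches_of_bondTouches hκ hb

variable {𝔹 : Type*} [CStarAlgebra 𝔹] [Nontrivial 𝔹]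

/-- **The Prop.-5 step in plain currency ⇒ the socket `hP5 m` of the `G`-VALUED Theorem-4 driver** (`B8Thm4SupportLocalBdryG` ∕ `B8Thm4InductionLocalG`):
`B8Prop5KLevelLetters.hP5_step_of_HFP` VERBATIM except that the displayed fixed point `λ` carries ONE more clause — `e^{iλ(x)} ∈ G` at every site (for
`G = SU(N)`: `λ` Hermitian AND TRACE-FREE, `B8SpecialUnitaryTrace.gaugeExp_mem_specialUnitaryUnits`; print p. 76 «G = SU(N)») — and the gauge transformation
`v := e^{iλ}` is returned `G`-VALUED instead of merely unitary.  Everything else (support, (1.108), the Landau condition of record for `U₁^{v⁻¹}`, (1.29) for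
`u₁·v`) byte-identical. [cite: Balaban1985RegularSpaces, Prop. 5 pp.93–94, (1.107)–(1.110) p.94, (1.86)–(1.88) p.91, (1.38) p.82, p.76] -/
theorem hP5_step_of_HFP_mem (hd2 : 2 ≤ d) {η : ℝ} (hη : 0 < η) (L m : ℕ) {G : Subgroup 𝔹ˣ} {U₀ : Site d → Fin d → 𝔹ˣ}
    (hU₀ : ∀ x κ, U₀ x κ ∈ unitaryUnits 𝔹) {cstar α₄ : ℝ} (hs₁ : α₄ ≤ 1 / 84) (hcs : cstar ≤ 1 / 12)
    (Ω : ℕ → Set (Site d)) (Λs : ℕ → ℕ → Set (Site d)) (u₁ : Site d → 𝔹ˣ) (U₁ : Site d → Fin d → 𝔹ˣ) (A : Site d → Fin d → 𝔹)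
    (hdat : ∀ j, j ≤ m → ∀ b ∈ {b : Site d × Fin d | SideTouches (Ω j) b.1 b.2},
      U₁ b.1 b.2 = cfgExp η A b.1 b.2 ∧ IsSelfAdjoint (A b.1 b.2) ∧ ‖A b.1 b.2‖ ≤ cstar * ((L : ℝ) ^ j * η)⁻¹)
    (hFP : ∃ lam : Site d → 𝔹, (∀ x, IsSelfAdjoint (lam x)) ∧ (∀ x, x ∉ Ω 0 → lam x = 0) ∧ (∀ x, gaugeExp lam x ∈ G) ∧
      (∀ j, j ≤ m + 1 → ∀ b ∈ {b : Site d × Fin d | SideTouches (Ω j) b.1 b.2},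
        ‖lam b.1‖ ≤ α₄ ∧ ((L : ℝ) ^ j * η) * ‖covDerivFwd η U₀ b.2 lam b.1‖ ≤ α₄) ∧
      (∃ μ : ℕ → Site d → 𝔹, ∀ x ∈ Ω 0,
        covLap η U₀ ((Ω 0).indicator fun y => covDivB η U₀ A y + covLap η U₀ lam y +
          ((conjR (gaugeExp lam y)⁻¹ (covDivB η U₀ A y) - covDivB η U₀ A y) +
            (gAd (covLap η U₀ lam y) (lam y) - covLap η U₀ lam y) + ∑ μ, frakF3 η U₀ lam A y μ)) x =
          QT L (m + 1) (Λs (m + 1)) U₀ μ x) ∧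
      Restr129 L (m + 1) (Λs (m + 1)) U₀ (u₁ * gaugeExp lam)) :
    ∃ (v : Site d → 𝔹ˣ) (lam : Site d → 𝔹), (∀ x, v x ∈ G) ∧ (∀ x, x ∉ Ω 0 → v x = 1) ∧
      (∀ j, j ≤ m + 1 → ∀ b ∈ {b : Site d × Fin d | SideTouches (Ω j) b.1 b.2}, (v b.1 : 𝔹) = ((gaugeExp lam b.1 : 𝔹ˣ) : 𝔹) ∧
        (v (b.1 + e b.2) : 𝔹) = ((gaugeExp lam (b.1 + e b.2) : 𝔹ˣ) : 𝔹)) ∧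
      (∀ j, j ≤ m + 1 → ∀ b ∈ {b : Site d × Fin d | SideTouches (Ω j) b.1 b.2},
        ‖lam b.1‖ ≤ α₄ ∧ ((L : ℝ) ^ j * η) * ‖covDerivFwd η U₀ b.2 lam b.1‖ ≤ α₄) ∧
      IsLandau138W L (m + 1) η (Ω 0) (Λs (m + 1)) U₀ (mgauge U₀ v⁻¹ U₁) ∧ Restr129 L (m + 1) (Λs (m + 1)) U₀ (u₁ * v) := by
  obtain ⟨lam, hsa, hoff, hlamG, h108, hmult, h129⟩ := hFP
  have hE0 : ∀ {y : Site d} {τ : Fin d}, BondTouches (Ω 0) y τ → (y, τ) ∈ {b : Site d × Fin d | SideTouches (Ω 0) b.1 b.2} :=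
    fun hb => sideTouches_of_bondTouches₂ hd2 hb
  have hα12 : α₄ ≤ 1 / 12 := hs₁.trans (by norm_num)
  have hα70 : α₄ ≤ 1 / 70 := hs₁.trans (by norm_num)
  have hd1 : 0 < d := by omega
  -- (1.108) at level `j = 0` on the bonds touching `Ω₀`
  have h0 : ∀ y τ, BondTouches (Ω 0) y τ → ‖lam y‖ ≤ α₄ ∧ η * ‖covDerivFwd η U₀ τ lam y‖ ≤ α₄ := fun y τ hb => by
    simpa only [pow_zero, one_mul] using h108 0 (Nat.zero_le _) (y, τ) (hE0 hb)
  have hl : ∀ x ∈ Ω 0, ‖lam x‖ ≤ 1 / 12 := fun x hx => (h0 x ⟨0, hd1⟩ (Or.inl hx)).1.trans hα12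
  have hD : ∀ x ∈ Ω 0, ∀ μ, η * ‖covDerivFwd η U₀ μ lam x‖ ≤ 1 / 70 := fun x hx μ => (h0 x μ (Or.inl hx)).2.trans hα70
  have hback : ∀ x ∈ Ω 0, ∀ μ : Fin d, BondTouches (Ω 0) (x - e μ) μ := fun x hx μ => Or.inr (by rwa [sub_add_cancel])
  have ha : ∀ x ∈ Ω 0, ∀ μ, η * ‖covDeriv η U₀ μ lam x‖ ≤ 1 / 70 := fun x hx μ => by
    rw [B8Eq151V2Divergence.norm_covDeriv_eq (unitaryUnits_le_U1 (hU₀ _ _)) lam]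
    exact (h0 _ μ (hback x hx μ)).2.trans hα70
  have hY : ∀ x ∈ Ω 0, ∀ μ, η * ‖conjR (U₀ (x - e μ) μ)⁻¹ (A (x - e μ) μ)‖ ≤ 1 / 12 := fun x hx μ => by
    obtain ⟨-, -, hA⟩ := hdat 0 (Nat.zero_le _) (x - e μ, μ) (hE0 (hback x hx μ))
    rw [B8Ineq132.norm_conjR ((U1 𝔹).inv_mem (unitaryUnits_le_U1 (hU₀ _ _)))]
    rw [pow_zero, one_mul] at hA
    calc η * ‖A (x - e μ) μ‖ ≤ η * (cstar * η⁻¹) := mul_le_mul_of_nonneg_left hA hη.le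
      _ = cstar := by rw [mul_left_comm, mul_inv_cancel₀ hη.ne', mul_one]
      _ ≤ 1 / 12 := hcs
  have hLan : IsLandau138W L (m + 1) η (Ω 0) (Λs (m + 1)) U₀ (mgauge U₀ (gaugeExp lam)⁻¹ (cfgExp η A)) :=
    isLandau138W_gaugeFixed_of_multiplier hη L (m + 1) (Ω 0) (Λs (m + 1)) U₀ A hl hD ha hY hmult
  have hcongr : ∀ (x : Site d) (μ : Fin d), BondTouches (Ω 0) x μ →
      mgauge U₀ (gaugeExp lam)⁻¹ U₁ x μ = mgauge U₀ (gaugeExp lam)⁻¹ (cfgExp η A) x μ := fun x μ hb => by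
    rw [mgauge_apply, mgauge_apply, (hdat 0 (Nat.zero_le _) (x, μ) (hE0 hb)).1]
  refine ⟨gaugeExp lam, lam, hlamG, fun x hx => ?_, fun j _ b _ => ⟨rfl, rfl⟩, h108,
    (B8Eq138LandauZd.isLandau138W_congr η L U₀ hcongr).mpr hLan, h129⟩
  · exact Units.ext (by rw [gaugeExp, hoff x hx, smul_zero, val_expUnit, NormedSpace.exp_zero, Units.val_one])


/-- **The socket `hP5` of the `G`-valued driver (`thm4_exists_all_levels_supp_landau138_γ_mem`), verbatim, from the fixed point in plain currency with the
`G`-clause `e^{iλ} ∈ G` at every level `1 ≤ m < k`** — `B8Prop5KLevelLetters.hP5_of_HFP` VERBATIM except: the level datum's `u₁` is `G`-valued (as the `G`-driver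
hands it over), the fixed point carries `∀ x, e^{iλ(x)} ∈ G`, and `v` is returned `G`-valued. [cite: Balaban1985RegularSpaces, Prop. 5 pp.93–94, (1.106)–(1.110) p.94, Thm 4 p.88, p.76] -/
theorem hP5_of_HFP_mem (hd2 : 2 ≤ d) {η : ℝ} (hη : 0 < η) (L k : ℕ) {G : Subgroup 𝔹ˣ} {U₀ U' : Site d → Fin d → 𝔹ˣ}
    (hU₀ : ∀ x κ, U₀ x κ ∈ unitaryUnits 𝔹) {cstar α₄ : ℝ} (hs₁ : α₄ ≤ 1 / 84) (hcs : cstar ≤ 1 / 12)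
    (Ω : ℕ → Set (Site d)) (Λs : ℕ → ℕ → Set (Site d))
    (HFP : ∀ m, 1 ≤ m → m < k → ∀ (u₁ : Site d → 𝔹ˣ) (U₁ : Site d → Fin d → 𝔹ˣ) (A : Site d → Fin d → 𝔹),
      (∀ x, u₁ x ∈ G) → (∀ x, x ∉ Ω 0 → u₁ x = 1) → mgauge U₀ u₁ U₁ = U' → Restr129 L m (Λs m) U₀ u₁ →
      IsLandau138W L m η (Ω 0) (Λs m) U₀ U₁ →
      (∀ j, j ≤ m → ∀ b ∈ {b : Site d × Fin d | SideTouches (Ω j) b.1 b.2},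
        U₁ b.1 b.2 = cfgExp η A b.1 b.2 ∧ IsSelfAdjoint (A b.1 b.2) ∧ ‖A b.1 b.2‖ ≤ cstar * ((L : ℝ) ^ j * η)⁻¹) →
      ∃ lam : Site d → 𝔹, (∀ x, IsSelfAdjoint (lam x)) ∧ (∀ x, x ∉ Ω 0 → lam x = 0) ∧ (∀ x, gaugeExp lam x ∈ G) ∧
        (∀ j, j ≤ m + 1 → ∀ b ∈ {b : Site d × Fin d | SideTouches (Ω j) b.1 b.2},
          ‖lam b.1‖ ≤ α₄ ∧ ((L : ℝ) ^ j * η) * ‖covDerivFwd η U₀ b.2 lam b.1‖ ≤ α₄) ∧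
        (∃ μ : ℕ → Site d → 𝔹, ∀ x ∈ Ω 0,
          covLap η U₀ ((Ω 0).indicator fun y => covDivB η U₀ A y + covLap η U₀ lam y +
            ((conjR (gaugeExp lam y)⁻¹ (covDivB η U₀ A y) - covDivB η U₀ A y) +
              (gAd (covLap η U₀ lam y) (lam y) - covLap η U₀ lam y) + ∑ μ, frakF3 η U₀ lam A y μ)) x =
            QT L (m + 1) (Λs (m + 1)) U₀ μ x) ∧
        Restr129 L (m + 1) (Λs (m + 1)) U₀ (u₁ * gaugeExp lam)) :
    ∀ m, 1 ≤ m → m < k → ∀ (u₁ : Site d → 𝔹ˣ) (U₁ : Site d → Fin d → 𝔹ˣ) (A : Site d → Fin d → 𝔹),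
      (∀ x, u₁ x ∈ G) → (∀ x, x ∉ Ω 0 → u₁ x = 1) → mgauge U₀ u₁ U₁ = U' → Restr129 L m (Λs m) U₀ u₁ →
      IsLandau138W L m η (Ω 0) (Λs m) U₀ U₁ →
      (∀ j, j ≤ m → ∀ b ∈ {b : Site d × Fin d | SideTouches (Ω j) b.1 b.2},
        U₁ b.1 b.2 = cfgExp η A b.1 b.2 ∧ IsSelfAdjoint (A b.1 b.2) ∧ ‖A b.1 b.2‖ ≤ cstar * ((L : ℝ) ^ j * η)⁻¹) →
      ∃ (v : Site d → 𝔹ˣ) (lam : Site d → 𝔹), (∀ x, v x ∈ G) ∧ (∀ x, x ∉ Ω 0 → v x = 1) ∧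
        (∀ j, j ≤ m + 1 → ∀ b ∈ {b : Site d × Fin d | SideTouches (Ω j) b.1 b.2}, (v b.1 : 𝔹) = ((gaugeExp lam b.1 : 𝔹ˣ) : 𝔹) ∧
          (v (b.1 + e b.2) : 𝔹) = ((gaugeExp lam (b.1 + e b.2) : 𝔹ˣ) : 𝔹)) ∧
        (∀ j, j ≤ m + 1 → ∀ b ∈ {b : Site d × Fin d | SideTouches (Ω j) b.1 b.2},
          ‖lam b.1‖ ≤ α₄ ∧ ((L : ℝ) ^ j * η) * ‖covDerivFwd η U₀ b.2 lam b.1‖ ≤ α₄) ∧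
        IsLandau138W L (m + 1) η (Ω 0) (Λs (m + 1)) U₀ (mgauge U₀ v⁻¹ U₁) ∧ Restr129 L (m + 1) (Λs (m + 1)) U₀ (u₁ * v) :=
  fun m hm hmk u₁ U₁ A hu₁ hsupp hfix h129 hLan hdat =>
    hP5_step_of_HFP_mem hd2 hη L m hU₀ hs₁ hcs Ω Λs u₁ U₁ A hdat (HFP m hm hmk u₁ U₁ A hu₁ hsupp hfix h129 hLan hdat)

/-- **The socket `hP5base` of the `G`-valued driver, verbatim** (the first step `u₁ = 1`, `U₁ = U′`): `B8Prop5KLevelLetters.hP5base_of_HFP` VERBATIM except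
that the plain-currency fixed point `HFP₀` carries `∀ x, e^{iλ(x)} ∈ G` and `v` is returned `G`-valued.  The level-0 datum `A₀ := (iη)⁻¹ log U′` is built exactly as
there (`B8Thm4TruncationLocal.base_datum`, `|U′ − 1| ≤ a ≤ 1/4`). [cite: Balaban1985RegularSpaces, Prop. 5 pp.93–94, (1.66) p.88, (1.106)–(1.110) p.94, p.76] -/
theorem hP5base_of_HFP_mem (hd2 : 2 ≤ d) {η : ℝ} (hη : 0 < η) (L : ℕ) {G : Subgroup 𝔹ˣ} {U₀ U' : Site d → Fin d → 𝔹ˣ}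
    (hU₀ : ∀ x κ, U₀ x κ ∈ unitaryUnits 𝔹) (hU' : ∀ x κ, U' x κ ∈ unitaryUnits 𝔹) {cstar α₄ a : ℝ} (hs₁ : α₄ ≤ 1 / 84)
    (hcs : cstar ≤ 1 / 12) (ha : a ≤ 1 / 4) (ha2 : 2 * a ≤ cstar) (Ω : ℕ → Set (Site d)) (Λs : ℕ → ℕ → Set (Site d))
    (h66 : ∀ b ∈ {b : Site d × Fin d | SideTouches (Ω 0) b.1 b.2}, ‖((U' b.1 b.2 : 𝔹ˣ) : 𝔹) - 1‖ ≤ a)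
    (HFP₀ : ∀ A : Site d → Fin d → 𝔹,
      (∀ j, j ≤ 0 → ∀ b ∈ {b : Site d × Fin d | SideTouches (Ω j) b.1 b.2},
        U' b.1 b.2 = cfgExp η A b.1 b.2 ∧ IsSelfAdjoint (A b.1 b.2) ∧ ‖A b.1 b.2‖ ≤ cstar * ((L : ℝ) ^ j * η)⁻¹) →
      ∃ lam : Site d → 𝔹, (∀ x, IsSelfAdjoint (lam x)) ∧ (∀ x, x ∉ Ω 0 → lam x = 0) ∧ (∀ x, gaugeExp lam x ∈ G) ∧
        (∀ j, j ≤ 1 → ∀ b ∈ {b : Site d × Fin d | SideTouches (Ω j) b.1 b.2},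
          ‖lam b.1‖ ≤ α₄ ∧ ((L : ℝ) ^ j * η) * ‖covDerivFwd η U₀ b.2 lam b.1‖ ≤ α₄) ∧
        (∃ μ : ℕ → Site d → 𝔹, ∀ x ∈ Ω 0,
          covLap η U₀ ((Ω 0).indicator fun y => covDivB η U₀ A y + covLap η U₀ lam y +
            ((conjR (gaugeExp lam y)⁻¹ (covDivB η U₀ A y) - covDivB η U₀ A y) +
              (gAd (covLap η U₀ lam y) (lam y) - covLap η U₀ lam y) + ∑ μ, frakF3 η U₀ lam A y μ)) x =
            QT L 1 (Λs 1) U₀ μ x) ∧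
        Restr129 L 1 (Λs 1) U₀ ((1 : Site d → 𝔹ˣ) * gaugeExp lam)) :
    ∃ (v : Site d → 𝔹ˣ) (lam : Site d → 𝔹), (∀ x, v x ∈ G) ∧ (∀ x, x ∉ Ω 0 → v x = 1) ∧
      (∀ j, j ≤ 1 → ∀ b ∈ {b : Site d × Fin d | SideTouches (Ω j) b.1 b.2}, (v b.1 : 𝔹) = ((gaugeExp lam b.1 : 𝔹ˣ) : 𝔹) ∧
        (v (b.1 + e b.2) : 𝔹) = ((gaugeExp lam (b.1 + e b.2) : 𝔹ˣ) : 𝔹)) ∧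
      (∀ j, j ≤ 1 → ∀ b ∈ {b : Site d × Fin d | SideTouches (Ω j) b.1 b.2},
        ‖lam b.1‖ ≤ α₄ ∧ ((L : ℝ) ^ j * η) * ‖covDerivFwd η U₀ b.2 lam b.1‖ ≤ α₄) ∧
      IsLandau138W L 1 η (Ω 0) (Λs 1) U₀ (mgauge U₀ v⁻¹ U') ∧ Restr129 L 1 (Λs 1) U₀ ((1 : Site d → 𝔹ˣ) * v) := by
  set A₀ : Site d → Fin d → 𝔹 := fun y μ => η⁻¹ • ((I⁻¹ : ℂ) • mlog ((U' y μ : 𝔹ˣ) : 𝔹))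
  have hdat : ∀ j, j ≤ 0 → ∀ b ∈ {b : Site d × Fin d | SideTouches (Ω j) b.1 b.2},
      U' b.1 b.2 = cfgExp η A₀ b.1 b.2 ∧ IsSelfAdjoint (A₀ b.1 b.2) ∧ ‖A₀ b.1 b.2‖ ≤ cstar * ((L : ℝ) ^ j * η)⁻¹ := by
    intro j hj b hb
    obtain rfl : j = 0 := Nat.le_zero.mp hj
    obtain ⟨-, hexp, hsa, hn⟩ := base_datum hη U₀ U' hU' ha b.1 b.2 (h66 b hb)
    refine ⟨hexp, hsa, hn.trans ?_⟩
    rw [pow_zero, one_mul]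
    exact mul_le_mul_of_nonneg_right ha2 (inv_nonneg.mpr hη.le)
  exact hP5_step_of_HFP_mem hd2 hη L 0 hU₀ hs₁ hcs Ω Λs 1 U' A₀ hdat (HFP₀ A₀ hdat)

end Assembly

#print axioms mem_of_mgauge_eq
#print axioms apply_eq_zero_of_cfgExp_mem_of_le_twelfth
#print axioms hP5_step_of_HFP_mem
#print axioms hP5_of_HFP_mem
#print axioms hP5base_of_HFP_mem

end Literature.MathematicalPhysics.QuantumFieldTheory.Balaban1983to89.B8Prop5KLevelLettersG

end
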